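import Summits.QuantumAdvantage.QuantumAdvantage.Theorems.CubicForrelationSignedExactCubicForrelationNotPrBPPGrowMachineClosedKset

/-!
# Crux `CubicForrelation.SignedExactCubicForrelationNotPrBPP` (stmt-QuantumAdvantage-13932), line `dual-pingpong-frame`
# (GROW reshape): the GROW machine, VII — dynamics of the two-sided closure

Proof-only support file (`--supports stmt-QuantumAdvantage-13932`) toward the registered stub `stub_growFinder`; sequel
of `…GrowMachineClosedKset.lean`. A row list `S` is a BASIS when `|span S| = 2^{|S|}`; the POTENTIAL of a pair is `|S| + |U|`.
For cubic `f`, `g` (circuit codes `c_f`, `c_g`; closedness predicates `Clf`, `Clg` as parameters):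

* one round `closeRound` keeps bases, only grows the spans, keeps the pair inside any closed pair of subspaces
  `(V, W)` containing it (`lamOf_subset`), is the identity on a pair passing both closedness checks, and otherwise raises
  the potential (`closeRound_progress`: a failed check exhibits a generator outside the span, so the new basis is longer);
* hence (`closure_closed`) from a pair of bases inside a closed pair `(V, W)` with `|V| = |W| = 2^m`, `n = 2m`, the
  `n + 1` rounds of `closure` end in a pair of bases inside `(V, W)` passing BOTH closedness checks: the potential is at
  most `2m = n` inside `(V, W)`, so some round is frozen, and frozen pairs stay frozen.

## References

* C. Carlet, *Boolean Functions for Cryptography and Coding Theory*, CUP 2021, Prop. 54. [Carlet2020]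
* D. E. Knuth, *TAOCP* Vol. 2, 3rd ed., §4.6.2 Algorithm N. [KnuthTAOCP2]
-/

noncomputable section

set_option linter.dupNamespace false -- D-0017: single-problem summit ⇒ `QuantumAdvantage.QuantumAdvantage` by design

namespace Summit.QuantumAdvantage.QuantumAdvantage.Theorems.SignedExactCubicForrelationNotPrBPP.GrowMachine

open Finset
open Literature.Computability.Complexity Literature.Computability.QuantumComplexity
open Literature.Computability.Complexity.F2Elim
open Literature.Computability.Complexity.BLR (toZ toZ_xor toZ_and toZ_injective)
open Literature.Computability.QuantumComplexity.BuzetChailloux (bxor zeroVec bxor_self bxor_comm bxor_zeroVec zeroVec_bxor)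
open PolarGeometry (toZ_bdot bdot_comm bdot_bxor_left bdot_bxor_right)
open NoTrap (bdot_zeroVec bdot_unit D_symm D_bxor_left D_zeroVec_eq)
open ForrCode QuadSampler MMReadout
open FinderMachine (Vec Mat normV basisOf kerOf inSpan)

variable {n : ℕ}

/-! ### Bases and spans of row lists -/

/-- `span [] = {0}`. [folklore] -/
theorem spanV_nil : spanV n ([] : Mat) = {zeroVec} := by
  ext v
  rw [mem_spanV, mem_singleton, rowSpan, show rowSet n ([] : Mat) = ∅ from Set.ext fun _ => ⟨fun ⟨_, h, _⟩ => absurd h List.not_mem_nil, False.elim⟩,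
    Submodule.span_empty, Submodule.mem_bot, show (0 : Fin n → ZMod 2) = bz zeroV from bz_zeroV.symm, bz_injective.eq_iff]; rfl

/-- The empty list is a basis: `|span []| = 2⁰`. [folklore] -/
theorem card_spanV_nil : (spanV n ([] : Mat)).card = 2 ^ ([] : Mat).length := by rw [spanV_nil, card_singleton]; rfl

/-- **`basisOf M` is a basis**: `|span (basisOf M)| = 2^{|basisOf M|}`. [cite: KnuthTAOCP2, §4.6.2 Algorithm N] -/
theorem card_spanV_basisOf (M : Mat) : (spanV n (basisOf n M)).card = 2 ^ (basisOf n M).length := by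
  rw [card_spanV, ← length_basisOf_eq_finrank_self]

/-- The length of a basis is the base-2 logarithm of its span: bases with nested spans have ordered lengths. [folklore] -/
theorem length_le_of_spanV_subset {S T : Mat} (hS : (spanV n S).card = 2 ^ S.length) (hT : (spanV n T).card = 2 ^ T.length)
    (h : spanV n S ⊆ spanV n T) : S.length ≤ T.length := by
  have := card_le_card h
  rw [hS, hT] at this
  exact (Nat.pow_le_pow_iff_right (by norm_num)).1 this

/-- A basis whose span is strictly contained in another basis's span is strictly shorter. [folklore] -/
theorem length_lt_of_spanV_ssubset {S T : Mat} (hS : (spanV n S).card = 2 ^ S.length) (hT : (spanV n T).card = 2 ^ T.length)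
    (h : spanV n S ⊂ spanV n T) : S.length < T.length := by
  have := card_lt_card h
  rw [hS, hT] at this
  exact (Nat.pow_lt_pow_iff_right (by norm_num)).1 this

/-- A basis inside a finset of size `2^m` has length `≤ m`. [folklore] -/
theorem length_le_of_spanV_subset_card {S : Mat} {V : Finset (Fin n → Bool)} {m : ℕ} (hS : (spanV n S).card = 2 ^ S.length)
    (hV : V.card = 2 ^ m) (h : spanV n S ⊆ V) : S.length ≤ m := by
  have := card_le_card h
  rw [hS, hV] at this
  exact (Nat.pow_le_pow_iff_right (by norm_num)).1 this

/-- `span M ⊆ span (basisOf (M ++ X))`. [folklore] -/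
theorem spanV_subset_basisOf_append_left (M X : Mat) : spanV n M ⊆ spanV n (basisOf n (M ++ X)) := by
  rw [spanV_basisOf]; exact spanV_mono fun r hr => List.mem_append_left _ hr

/-- The rows of `X` lie in `span (basisOf (M ++ X))`. [folklore] -/
theorem toInput_mem_spanV_basisOf_append_right (M : Mat) {X : Mat} {x : List Bool} (hx : x ∈ X) :
    toInput n x ∈ spanV n (basisOf n (M ++ X)) := by
  rw [spanV_basisOf]; exact toInput_mem_spanV (List.mem_append_right _ hx)

/-- `span (basisOf (M ++ X)) ⊆ W` when `span M ⊆ W`, the rows of `X` lie in `W` and `W` is a subspace. [folklore] -/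
theorem spanV_basisOf_append_subset {M X : Mat} {W : Finset (Fin n → Bool)} (hW0 : zeroVec ∈ W)
    (hWadd : ∀ x ∈ W, ∀ y ∈ W, bxor x y ∈ W) (hM : spanV n M ⊆ W) (hX : ∀ x ∈ X, toInput n x ∈ W) :
    spanV n (basisOf n (M ++ X)) ⊆ W := by
  rw [spanV_basisOf]
  refine spanV_subset_of_rows hW0 hWadd fun r hr => ?_
  rcases List.mem_append.1 hr with h | h
  · exact hM (toInput_mem_spanV h)
  · exact hX r h

/-- A failed closedness check exhibits a generator outside the span. [folklore] -/
theorem exists_of_closedChk_eq_false {c : PCirc} {S U : Mat} (h : closedChk n c S U = false) :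
    ∃ x ∈ lamOf n c S, toInput n x ∉ spanV n U := by
  rw [closedChk, List.all_eq_false] at h
  obtain ⟨x, hx, hnot⟩ := h
  exact ⟨x, hx, fun hmem => hnot ((inSpan_eq_true_iff U x).2 hmem)⟩

/-! ### One round of the closure -/

section Round

variable {f g : (Fin n → Bool) → Bool} (Df Dg : (Fin n → Bool) → (Fin n → Bool) → (Fin n → Bool) → Bool)
  (hDf : ∀ u v x, Df u v x = (f x ^^ f (bxor x u) ^^ f (bxor x v) ^^ f (bxor x (bxor u v))))
  (hDg : ∀ u v x, Dg u v x = (g x ^^ g (bxor x u) ^^ g (bxor x v) ^^ g (bxor x (bxor u v))))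
  {cf cg : PCirc} (hf : ∀ v, evalP cf v = f (toInput n v)) (hg : ∀ v, evalP cg v = g (toInput n v))
  (hf3 : IsDegLeFun 3 f) (hg3 : IsDegLeFun 3 g)
  (Clf Clg : Finset (Fin n → Bool) → Finset (Fin n → Bool) → Prop)
  (hClf : ∀ A B, Clf A B ↔
    ((∀ s ∈ A, ∀ y : Fin n → Bool, (fun k => (Df s y zeroVec ^^ Df s y (fun j => decide (j = k)))) ∈ B) ∧
     (∀ s ∈ A, ∃ ℓ ∈ B, ∀ r : Fin n → Bool, (∀ y z : Fin n → Bool, (Df s r z ^^ Df s r (bxor z y)) = false) →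
        Df s r zeroVec = (univ.filter fun i => ℓ i && r i).card.bodd)))
  (hClg : ∀ A B, Clg A B ↔
    ((∀ s ∈ A, ∀ y : Fin n → Bool, (fun k => (Dg s y zeroVec ^^ Dg s y (fun j => decide (j = k)))) ∈ B) ∧
     (∀ s ∈ A, ∃ ℓ ∈ B, ∀ r : Fin n → Bool, (∀ y z : Fin n → Bool, (Dg s r z ^^ Dg s r (bxor z y)) = false) →
        Dg s r zeroVec = (univ.filter fun i => ℓ i && r i).card.bodd)))

/-- A pair passing both closedness checks is frozen. [folklore] -/
theorem closeRound_eq_self {q : Mat × Mat} (h1 : closedChk n cg q.1 q.2 = true) (h2 : closedChk n cf q.2 q.1 = true) :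
    closeRound n cf cg q = q := by
  rw [closeRound, if_pos h1, if_pos h2]

/-- One round keeps bases. [cite: KnuthTAOCP2, §4.6.2 Algorithm N] -/
theorem closeRound_basis {q : Mat × Mat} (h1 : (spanV n q.1).card = 2 ^ q.1.length) (h2 : (spanV n q.2).card = 2 ^ q.2.length) :
    (spanV n (closeRound n cf cg q).1).card = 2 ^ (closeRound n cf cg q).1.length ∧
      (spanV n (closeRound n cf cg q).2).card = 2 ^ (closeRound n cf cg q).2.length := by
  unfold closeRound; split_ifs
  · exact ⟨h1, h2⟩
  · exact ⟨card_spanV_basisOf _, h2⟩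
  · exact ⟨h1, card_spanV_basisOf _⟩

/-- One round only grows the spans. [folklore] -/
theorem closeRound_span_mono (q : Mat × Mat) :
    spanV n q.1 ⊆ spanV n (closeRound n cf cg q).1 ∧ spanV n q.2 ⊆ spanV n (closeRound n cf cg q).2 := by
  unfold closeRound; split_ifs
  · exact ⟨Subset.rfl, Subset.rfl⟩
  · exact ⟨spanV_subset_basisOf_append_left _ _, Subset.rfl⟩
  · exact ⟨Subset.rfl, spanV_subset_basisOf_append_left _ _⟩

include hDf hDg hf hg hf3 hg3 hClf hClg in
/-- **One round stays inside a closed pair of subspaces** `(V, W)` containing the pair. [cite: Carlet2020, Prop. 54] -/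
theorem closeRound_inside {V W : Finset (Fin n → Bool)} (hV0 : zeroVec ∈ V) (hVadd : ∀ x ∈ V, ∀ y ∈ V, bxor x y ∈ V)
    (hW0 : zeroVec ∈ W) (hWadd : ∀ x ∈ W, ∀ y ∈ W, bxor x y ∈ W) (hgVW : Clg V W) (hfWV : Clf W V)
    {q : Mat × Mat} (h1 : spanV n q.1 ⊆ V) (h2 : spanV n q.2 ⊆ W) :
    spanV n (closeRound n cf cg q).1 ⊆ V ∧ spanV n (closeRound n cf cg q).2 ⊆ W := by
  unfold closeRound; split_ifs
  · exact ⟨h1, h2⟩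
  · exact ⟨spanV_basisOf_append_subset hV0 hVadd h1
      (lamOf_subset Df hDf hf hf3 Clf hClf hV0 hVadd hfWV fun s hs => h2 (toInput_mem_spanV hs)), h2⟩
  · exact ⟨h1, spanV_basisOf_append_subset hW0 hWadd h2
      (lamOf_subset Dg hDg hg hg3 Clg hClg hW0 hWadd hgVW fun s hs => h1 (toInput_mem_spanV hs))⟩

/-- **An unfrozen round raises the potential.** [cite: KnuthTAOCP2, §4.6.2 Algorithm N] -/
theorem closeRound_progress {q : Mat × Mat} (h1 : (spanV n q.1).card = 2 ^ q.1.length) (h2 : (spanV n q.2).card = 2 ^ q.2.length)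
    (hnf : ¬ (closedChk n cg q.1 q.2 = true ∧ closedChk n cf q.2 q.1 = true)) :
    q.1.length + q.2.length + 1 ≤ (closeRound n cf cg q).1.length + (closeRound n cf cg q).2.length := by
  unfold closeRound
  split_ifs with hc1 hc2
  · exact absurd ⟨hc1, hc2⟩ hnf
  · -- the `f`-check failed: `S` grows
    have hc2' : closedChk n cf q.2 q.1 = false := by simpa using hc2
    obtain ⟨x, hx, hxS⟩ := exists_of_closedChk_eq_false hc2'
    have hlt : q.1.length < (basisOf n (q.1 ++ lamOf n cf q.2)).length :=
      length_lt_of_spanV_ssubset h1 (card_spanV_basisOf _)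
        (Finset.ssubset_iff_subset_ne.2 ⟨spanV_subset_basisOf_append_left _ _, fun heq => hxS (heq ▸ toInput_mem_spanV_basisOf_append_right _ hx)⟩)
    show q.1.length + q.2.length + 1 ≤ (basisOf n (q.1 ++ lamOf n cf q.2)).length + q.2.length
    omega
  · -- the `g`-check failed: `U` grows
    have hc1' : closedChk n cg q.1 q.2 = false := by simpa using hc1
    obtain ⟨x, hx, hxU⟩ := exists_of_closedChk_eq_false hc1'
    have hlt : q.2.length < (basisOf n (q.2 ++ lamOf n cg q.1)).length :=
      length_lt_of_spanV_ssubset h2 (card_spanV_basisOf _)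
        (Finset.ssubset_iff_subset_ne.2 ⟨spanV_subset_basisOf_append_left _ _, fun heq => hxU (heq ▸ toInput_mem_spanV_basisOf_append_right _ hx)⟩)
    show q.1.length + q.2.length + 1 ≤ q.1.length + (basisOf n (q.2 ++ lamOf n cg q.1)).length
    omega

/-! ### The closure: `n + 1` rounds -/

/-- The closure keeps bases and only grows the spans. [cite: KnuthTAOCP2, §4.6.2 Algorithm N] -/
theorem closure_basis_mono {q : Mat × Mat} (h1 : (spanV n q.1).card = 2 ^ q.1.length) (h2 : (spanV n q.2).card = 2 ^ q.2.length) :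
    (spanV n (closure n cf cg q).1).card = 2 ^ (closure n cf cg q).1.length ∧
      (spanV n (closure n cf cg q).2).card = 2 ^ (closure n cf cg q).2.length ∧
      spanV n q.1 ⊆ spanV n (closure n cf cg q).1 ∧ spanV n q.2 ⊆ spanV n (closure n cf cg q).2 := by
  unfold closure
  induction (n + 1) with
  | zero => exact ⟨h1, h2, Subset.rfl, Subset.rfl⟩
  | succ k ih =>
    rw [List.replicate_succ', List.foldl_append, List.foldl_cons, List.foldl_nil]
    obtain ⟨i1, i2, i3, i4⟩ := ih
    obtain ⟨b1, b2⟩ := closeRound_basis (cf := cf) (cg := cg) i1 i2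
    obtain ⟨m1, m2⟩ := closeRound_span_mono (cf := cf) (cg := cg) ((List.replicate k ()).foldl (fun q _ => closeRound n cf cg q) q)
    exact ⟨b1, b2, i3.trans m1, i4.trans m2⟩

include hDf hDg hf hg hf3 hg3 hClf hClg in
/-- **The closure of a pair inside a closed pair `(V, W)` with `|V| = |W| = 2^m`, `n = 2m`, ends frozen**: after the
`n + 1` rounds the pair consists of bases inside `(V, W)` passing both closedness checks (the potential is bounded by
`n` inside `(V, W)`, so some round is frozen, and frozen pairs stay frozen). [cite: Carlet2020, Prop. 54] -/
theorem closure_closed {m : ℕ} (hn : n = m + m) {V W : Finset (Fin n → Bool)} (hV0 : zeroVec ∈ V)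
    (hVadd : ∀ x ∈ V, ∀ y ∈ V, bxor x y ∈ V) (hW0 : zeroVec ∈ W) (hWadd : ∀ x ∈ W, ∀ y ∈ W, bxor x y ∈ W)
    (hVc : V.card = 2 ^ m) (hWc : W.card = 2 ^ m) (hgVW : Clg V W) (hfWV : Clf W V)
    {q : Mat × Mat} (hb1 : (spanV n q.1).card = 2 ^ q.1.length) (hb2 : (spanV n q.2).card = 2 ^ q.2.length)
    (h1 : spanV n q.1 ⊆ V) (h2 : spanV n q.2 ⊆ W) :
    spanV n (closure n cf cg q).1 ⊆ V ∧ spanV n (closure n cf cg q).2 ⊆ W ∧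
      closedChk n cg (closure n cf cg q).1 (closure n cf cg q).2 = true ∧ closedChk n cf (closure n cf cg q).2 (closure n cf cg q).1 = true := by
  -- invariant along the rounds: bases, inside, and (frozen ∨ potential ≥ initial + #rounds)
  have key : ∀ k : ℕ,
      let r := (List.replicate k ()).foldl (fun q _ => closeRound n cf cg q) q
      (spanV n r.1).card = 2 ^ r.1.length ∧ (spanV n r.2).card = 2 ^ r.2.length ∧ spanV n r.1 ⊆ V ∧ spanV n r.2 ⊆ W ∧
        ((closedChk n cg r.1 r.2 = true ∧ closedChk n cf r.2 r.1 = true) ∨ q.1.length + q.2.length + k ≤ r.1.length + r.2.length) := by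
    intro k
    induction k with
    | zero => exact ⟨hb1, hb2, h1, h2, Or.inr le_rfl⟩
    | succ k ih =>
      obtain ⟨i1, i2, i3, i4, i5⟩ := ih
      simp only [List.replicate_succ', List.foldl_append, List.foldl_cons, List.foldl_nil]
      set r := (List.replicate k ()).foldl (fun q _ => closeRound n cf cg q) q with hr
      obtain ⟨b1, b2⟩ := closeRound_basis (cf := cf) (cg := cg) i1 i2
      obtain ⟨c1, c2⟩ := closeRound_inside Df Dg hDf hDg hf hg hf3 hg3 Clf Clg hClf hClg hV0 hVadd hW0 hWadd hgVW hfWV i3 i4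
      refine ⟨b1, b2, c1, c2, ?_⟩
      by_cases hfr : closedChk n cg r.1 r.2 = true ∧ closedChk n cf r.2 r.1 = true
      · left; rw [closeRound_eq_self hfr.1 hfr.2]; exact hfr
      · rcases i5 with h | h
        · exact absurd h hfr
        · right
          have := closeRound_progress (cf := cf) (cg := cg) i1 i2 hfr
          omega
  obtain ⟨k1, k2, k3, k4, k5⟩ := key (n + 1)
  refine ⟨k3, k4, ?_⟩
  rcases k5 with h | h
  · exact h
  · exfalso
    have l1 := length_le_of_spanV_subset_card k1 hVc k3
    have l2 := length_le_of_spanV_subset_card k2 hWc k4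
    omega

end Round

/-- **`basisOf M` is a basis** (registered brick `grow_cardSpanBasis` of stub `stub_growFinder`, line `dual-pingpong-frame`, crux stmt-QuantumAdvantage-13932). [cite: KnuthTAOCP2, §4.6.2 Algorithm N] -/
theorem grow_cardSpanBasis : ∀ {n : ℕ} (M : List (List Bool)), (MMReadout.spanV n (FinderMachine.basisOf n M)).card = 2 ^ (FinderMachine.basisOf n M).length :=
  fun M => card_spanV_basisOf M

end Summit.QuantumAdvantage.QuantumAdvantage.Theorems.SignedExactCubicForrelationNotPrBPP.GrowMachine

end
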